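import Mathlib
import Summits.MatrixMultiplication.MatrixMultiplication.Theorems.SubgroupIdentityDesigns.Negative.ParabolicSubgroup
import Summits.MatrixMultiplication.MatrixMultiplication.Theorems.SubgroupIdentityDesigns.Negative.ParabolicBruhat

/-!
# The double-coset invariant `dim(E_c ∩ s E_j)` for `P_c \ GL_N(F) / P_j`

Support file toward the maximal-parabolic Mackey formula `SteinbergTower.MackeyFormula`
(crux `SubgroupIdentityDesigns`, negative side; VALUE = reusable linear-algebra bookkeeping,
NOT summit progress).

`ParabolicBruhat.exists_swap_dcoset` puts every `s ∈ GL_N(F)` in some double coset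
`P_c w(π_i) P_j`.  Here we separate these double cosets by the elementary invariant

  `ι(s) = #(E_c ∩ s E_j) = #{v : v_r = 0 (r ≥ c), (s⁻¹ v)_r = 0 (r ≥ j)}`     (`iota`)

(`E_c = ⟨e_0, …, e_{c-1}⟩`; `P_c = Stab E_c`): `ι(p s q) = ι(s)` for `p ∈ P_c`, `q ∈ P_j`
(`iota_parab_mul`, `iota_mul_parab`), and `ι(w(σ)) = |F| ^ #{x < j : σ x < c}` (`iota_permGL`).
Hence the **class** `cls s = log_|F| ι(s)` of `s` is the unique admissible `i` with
`s ∈ P_c w(π_i) P_j` (`cls_spec`, `cls_swap_dcoset`).  [folklore]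
-/

set_option linter.dupNamespace false
set_option maxHeartbeats 800000

noncomputable section

open scoped BigOperators Classical
open Literature.RepresentationTheory.FiniteGroups

namespace Summit.MatrixMultiplication.MatrixMultiplication.Theorems.SubgroupIdentityDesigns.Negative

namespace ParabolicClass

open ParabolicSubgroup ParabolicBruhat

variable {F : Type} [Field F] [Fintype F] [DecidableEq F] {N c j : ℕ}

/-! ## The subspaces `E_c` and their stabilisers -/

/-- `E_c`: the vectors vanishing at the coordinates `≥ c`. -/
def lowSet (c : ℕ) : Set (Fin N → F) := {v | ∀ r : Fin N, c ≤ (r : ℕ) → v r = 0}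

omit [Fintype F] [DecidableEq F] in
/-- Membership in `E_c`. -/
theorem mem_lowSet {v : Fin N → F} :
    v ∈ lowSet (F := F) c ↔ ∀ r : Fin N, c ≤ (r : ℕ) → v r = 0 := Iff.rfl

/-- `P_c` maps `E_c` into itself. -/
theorem low_mulVec {g : GL (Fin N) F} (hg : g ∈ parab F N c) {v : Fin N → F} (hv : v ∈ lowSet c) :
    (g : Matrix (Fin N) (Fin N) F).mulVec v ∈ lowSet c := by
  intro r hr
  simp only [Matrix.mulVec, dotProduct]
  refine Finset.sum_eq_zero fun t _ => ?_
  by_cases ht : (t : ℕ) < c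
  · rw [mem_parab.mp hg r t ht hr, zero_mul]
  · rw [hv t (by omega), mul_zero]

/-- For `g ∈ P_c`: `g v ∈ E_c ↔ v ∈ E_c`. -/
theorem low_mulVec_iff {g : GL (Fin N) F} (hg : g ∈ parab F N c) (v : Fin N → F) :
    (g : Matrix (Fin N) (Fin N) F).mulVec v ∈ lowSet c ↔ v ∈ lowSet c := by
  refine ⟨fun h => ?_, low_mulVec hg⟩
  have h2 := low_mulVec ((parab F N c).inv_mem hg) h
  rwa [Matrix.mulVec_mulVec, ← Units.val_mul, inv_mul_cancel, Units.val_one, Matrix.one_mulVec]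
    at h2

/-! ## The invariant `ι(s) = #(E_c ∩ s E_j)` -/

/-- `E_c ∩ s E_j` as a finset of vectors: `v ∈ E_c` with `s⁻¹ v ∈ E_j`. -/
def meetVec (c j : ℕ) (s : GL (Fin N) F) : Finset (Fin N → F) :=
  Finset.univ.filter fun v =>
    v ∈ lowSet c ∧ (((s⁻¹ : GL (Fin N) F) : Matrix (Fin N) (Fin N) F).mulVec v) ∈ lowSet j

omit [DecidableEq F] in
/-- Membership in `E_c ∩ s E_j`. -/
theorem mem_meetVec {s : GL (Fin N) F} {v : Fin N → F} :
    v ∈ meetVec c j s ↔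
      v ∈ lowSet c ∧ (((s⁻¹ : GL (Fin N) F) : Matrix (Fin N) (Fin N) F).mulVec v) ∈ lowSet j := by
  simp [meetVec]

/-- **The invariant** `ι(s) = #(E_c ∩ s E_j)`. -/
def iota (c j : ℕ) (s : GL (Fin N) F) : ℕ := (meetVec c j s).card

/-- `E_c ∩ (p s) E_j = p (E_c ∩ s E_j)` for `p ∈ P_c`. -/
theorem meetVec_parab_mul {p : GL (Fin N) F} (hp : p ∈ parab F N c) (s : GL (Fin N) F) :
    meetVec c j (p * s) = (meetVec c j s).image fun v => (p : Matrix (Fin N) (Fin N) F).mulVec v := by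
  ext v
  simp only [mem_meetVec, Finset.mem_image]
  constructor
  · rintro ⟨h1, h2⟩
    refine ⟨((p⁻¹ : GL (Fin N) F) : Matrix (Fin N) (Fin N) F).mulVec v, ⟨?_, ?_⟩, ?_⟩
    · exact low_mulVec ((parab F N c).inv_mem hp) h1
    · rwa [Matrix.mulVec_mulVec, ← Units.val_mul, ← mul_inv_rev]
    · rw [Matrix.mulVec_mulVec, ← Units.val_mul, mul_inv_cancel, Units.val_one, Matrix.one_mulVec]
  · rintro ⟨w, ⟨h1, h2⟩, rfl⟩
    refine ⟨low_mulVec hp h1, ?_⟩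
    rw [Matrix.mulVec_mulVec, ← Units.val_mul, mul_inv_rev, inv_mul_cancel_right]
    exact h2

omit [Fintype F] [DecidableEq F] in
/-- `v ↦ p v` is injective for `p ∈ GL_N(F)`. -/
theorem mulVec_injective (p : GL (Fin N) F) :
    Function.Injective fun v : Fin N → F => (p : Matrix (Fin N) (Fin N) F).mulVec v := by
  intro v w h
  have h2 := congrArg (fun u => ((p⁻¹ : GL (Fin N) F) : Matrix (Fin N) (Fin N) F).mulVec u) h
  simpa only [Matrix.mulVec_mulVec, ← Units.val_mul, inv_mul_cancel, Units.val_one,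
    Matrix.one_mulVec] using h2

/-- **Left invariance**: `ι(p s) = ι(s)` for `p ∈ P_c`. -/
theorem iota_parab_mul {p : GL (Fin N) F} (hp : p ∈ parab F N c) (s : GL (Fin N) F) :
    iota c j (p * s) = iota c j s := by
  unfold iota
  rw [meetVec_parab_mul hp s, Finset.card_image_of_injective _ (mulVec_injective p)]

/-- **Right invariance**: `ι(s q) = ι(s)` for `q ∈ P_j` (indeed `E_c ∩ s q E_j = E_c ∩ s E_j`). -/
theorem iota_mul_parab (s : GL (Fin N) F) {q : GL (Fin N) F} (hq : q ∈ parab F N j) :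
    iota c j (s * q) = iota c j s := by
  unfold iota
  congr 1
  ext v
  simp only [mem_meetVec]
  rw [mul_inv_rev, Units.val_mul, ← Matrix.mulVec_mulVec,
    low_mulVec_iff ((parab F N j).inv_mem hq)]

/-! ## The value on permutation matrices -/

/-- Vectors supported in a finset `S` number `|F| ^ #S`. -/
theorem card_supported (S : Finset (Fin N)) :
    (Finset.univ.filter fun v : Fin N → F => ∀ t, t ∉ S → v t = 0).card =
      Fintype.card F ^ S.card := by
  let e : (S → F) → (Fin N → F) := fun w t => if h : t ∈ S then w ⟨t, h⟩ else 0
  have he : Function.Injective e := by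
    intro w w' h
    funext ⟨t, ht⟩
    have := congrFun h t
    simpa only [e, dif_pos ht] using this
  have himg : (Finset.univ.filter fun v : Fin N → F => ∀ t, t ∉ S → v t = 0) =
      Finset.univ.image e := by
    ext v
    simp only [Finset.mem_filter, Finset.mem_univ, true_and, Finset.mem_image]
    constructor
    · intro hv
      refine ⟨fun t => v t, funext fun t => ?_⟩
      by_cases ht : t ∈ S
      · simp only [e, dif_pos ht]
      · simp only [e, dif_neg ht, hv t ht]
    · rintro ⟨w, rfl⟩ t ht
      simp only [e, dif_neg ht]
  rw [himg, Finset.card_image_of_injective _ he, Finset.card_univ, Fintype.card_fun,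
    Fintype.card_coe]

omit [Fintype F] [DecidableEq F] in
/-- `(w(σ)⁻¹ v)_r = v_{σ r}`. -/
theorem permGL_inv_mulVec (σ : Equiv.Perm (Fin N)) (v : Fin N → F) (r : Fin N) :
    (((permGL σ : GL (Fin N) F)⁻¹ : GL (Fin N) F) : Matrix (Fin N) (Fin N) F).mulVec v r =
      v (σ r) := by
  rw [permGL_inv]
  simp only [Matrix.mulVec, dotProduct]
  rw [Finset.sum_eq_single (σ r)]
  · rw [permGL_apply, if_pos (by simp), one_mul]
  · intro t _ ht
    rw [permGL_apply, if_neg, zero_mul]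
    intro h
    apply ht
    rw [h]
    simp
  · intro h
    exact absurd (Finset.mem_univ _) h

/-- **`ι(w(σ)) = |F| ^ #{x < j : σ x < c}`**: `E_c ∩ w(σ) E_j` is spanned by the `e_t` with
`t < c` and `σ⁻¹ t < j`. -/
theorem iota_permGL (σ : Equiv.Perm (Fin N)) :
    iota c j (permGL σ : GL (Fin N) F) = Fintype.card F ^ cnt c j σ (true, true) := by
  let S : Finset (Fin N) := Finset.univ.filter fun t => (t : ℕ) < c ∧ ((σ⁻¹ t : Fin N) : ℕ) < j
  have hS : S.card = cnt c j σ (true, true) := by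
    unfold cnt
    have e : S = (Finset.univ.filter fun x : Fin N => pat c j σ x = (true, true)).map
        σ.toEmbedding := by
      ext t
      simp only [S, Finset.mem_filter, Finset.mem_univ, true_and, Finset.mem_map,
        Equiv.toEmbedding_apply, pat, Prod.mk.injEq, decide_eq_true_eq]
      constructor
      · rintro ⟨h1, h2⟩
        exact ⟨σ⁻¹ t, ⟨h2, by simpa using h1⟩, by simp⟩
      · rintro ⟨x, ⟨h1, h2⟩, rfl⟩
        exact ⟨h2, by simpa using h1⟩
    rw [e, Finset.card_map]
  unfold iota
  rw [← hS, ← card_supported S]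
  congr 1
  ext v
  simp only [mem_meetVec, Finset.mem_filter, Finset.mem_univ, true_and, mem_lowSet,
    permGL_inv_mulVec, S, not_and, not_lt]
  constructor
  · rintro ⟨h1, h2⟩ t ht
    by_cases htc : (t : ℕ) < c
    · have h3 := h2 (σ⁻¹ t) (ht htc)
      simpa using h3
    · exact h1 t (by omega)
  · intro h
    refine ⟨fun r hr => h r (fun h' => by omega), fun r hr => h (σ r) (fun _ => by simpa using hr)⟩

/-! ## The class of an element -/

/-- **The class** `cls s = log_|F| ι(s)`: the index `i` of the double coset `P_c w(π_i) P_j ∋ s`. -/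
def cls (c j : ℕ) (s : GL (Fin N) F) : ℕ := Nat.log (Fintype.card F) (iota c j s)

/-- `cls (p w(σ) q) = #{x < j : σ x < c}`. -/
theorem cls_dcoset (σ : Equiv.Perm (Fin N)) {p q : GL (Fin N) F} (hp : p ∈ parab F N c)
    (hq : q ∈ parab F N j) : cls c j (p * permGL σ * q) = cnt c j σ (true, true) := by
  unfold cls
  rw [iota_mul_parab _ hq, iota_parab_mul hp, iota_permGL, Nat.log_pow Fintype.one_lt_card]

/-- **`cls` on the double coset of `w(π_i)` is `i`** (admissible `i`). -/
theorem cls_swap_dcoset {i : ℕ} (hic : i ≤ c) (hij : i ≤ j) (hc : c ≤ N) (h : c + j ≤ N + i)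
    {p q : GL (Fin N) F} (hp : p ∈ parab F N c) (hq : q ∈ parab F N j) :
    cls c j (p * permGL (swapPerm N c j i) * q) = i := by
  rw [cls_dcoset _ hp hq, cnt_swapPerm hic hij hc h]

/-- **Classification**: `cls s` is admissible and `s ∈ P_c w(π_{cls s}) P_j`. -/
theorem cls_spec (hc : c ≤ N) (hj : j ≤ N) (s : GL (Fin N) F) :
    cls c j s ≤ c ∧ cls c j s ≤ j ∧ c + j ≤ N + cls c j s ∧
      ∃ p ∈ parab F N c, ∃ q ∈ parab F N j, s = p * permGL (swapPerm N c j (cls c j s)) * q := by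
  obtain ⟨i, h1, h2, h3, p, hp, q, hq, rfl⟩ := exists_swap_dcoset hc hj s
  rw [cls_swap_dcoset h1 h2 hc h3 hp hq]
  exact ⟨h1, h2, h3, p, hp, q, hq, rfl⟩

/-- `cls s ≤ min c j`. -/
theorem cls_le_min (hc : c ≤ N) (hj : j ≤ N) (s : GL (Fin N) F) : cls c j s ≤ min c j := by
  obtain ⟨h1, h2, -⟩ := cls_spec hc hj s
  exact le_min h1 h2

end ParabolicClass

end Summit.MatrixMultiplication.MatrixMultiplication.Theorems.SubgroupIdentityDesigns.Negative

end
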